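import Summits.SmoothPoincare4.SmoothPoincare4.Theses.ConvexBisection
import Summits.SmoothPoincare4.SmoothPoincare4.Theorems.ContractibleTwistedDoubleStandard.Negative.LoadBearing
import Literature.Topology.FourManifolds.Handles
import Literature.Topology.FourManifolds.Gluing
import Literature.Topology.FourManifolds.HandleAttachingMaps
import Literature.Topology.FourManifolds.SmoothOrientation
import Literature.Geometry.Symplectic.SteinBoundaryContact
import Literature.Geometry.Symplectic.SteinFillingSphere
import Literature.Geometry.Symplectic.BoundaryContactomorphism
import Literature.Topology.FourManifolds.CerfGammaFour
import Summits.SmoothPoincare4.SmoothPoincare4.Theorems.ConvexBisectionContractibleTwistedDoubleStandardStubSeam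
import HarnessLib.Audit

/-!
# Line `property-r-mazur-halves` — skeleton for crux `ConvexBisection.ContractibleTwistedDoubleStandard`
(stmt-SmoothPoincare4-3546), idea card `Cruxes/ContractibleTwistedDoubleStandard/Ideas/property-r-mazur-halves.md`.

Crux (fixed, never restated): a closed smooth 4-manifold `X` which is a Stein bisection along a
common contact seam of two compact CONTRACTIBLE Stein domains `(W₁,J₁)`, `(W₂,J₂)` is `S⁴`.

The line (card + triage r1-1/2/3): for MAZUR-TYPE halves (Stein handle structure
`S¹ × B³ ∪` one Weinstein 2-handle) the whole 4-dimensional difficulty of `X = W₁ ∪_ψ W̄₂` is ONE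
1-handle; turning `W̄₂` upside down gives `X = (W₁ ∪_Λ h²) ∪ (S¹ × B³)` with `Λ = ψ⁻¹(belt circle)`
LEGENDRIAN in `(∂W₁, ξ₁)` and framed `tb(Λ) + 1` (twisting `+1`); if the 1-handle of `W₁` cancels in
`P = W₁ ∪_Λ h²` (the BET: the contact constraints force it), `P` is a knot trace with boundary
`S¹ × S²`, GABAI'S PROPERTY R makes it `S² × D²`, and LAUDENBACH–POÉNARU closes `X ≅ S⁴`.

Sector structure (honest): the lever reaches the halves that are STEIN-SMALL — some Stein structure on
the same `Wᵢ` inducing the same contact planes along `∂Wᵢ` (same `J`, or a Gray pull-back of a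
Stein-homotopic one) has a MORSE `J`-convex function with at most one critical point (ball type; seam
`S³`, Eliashberg) or with profile `(1,1,1)` (Mazur type: `S¹ × B³ ∪` one Weinstein 2-handle — all
classical corks, Gompf's `ℤ`-corks, KOU's Legendrian structure `J₁` on the Akbulut cork).  The complement
("some half needs ≥ 2 one-handles in every such Stein handle structure") is the residual stub
`stub_nonMazurSector`: it is NOT reached by this lever (barrier
`Literature.Barriers.SmoothPoincare4.StrictPropertyTwoRBarrier` / Andrews–Curtis bites there, as the card
concedes) and is filed so that the composition concludes the crux BY NAME; the lead should source
it from line `legendrian-belt-unlinking` (LPR, `n ≥ 2`) — see `Lines/property-r-mazur-halves.md`.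

Stubs (5): `stub_ballHalf` (M, theorem-level modulo named facts), `stub_upsideDownLegendrianDual`
(L, theorem-level: Weinstein co-core is a Lagrangian disc ⇒ belt circle Legendrian with `tb_D = -1`),
`stub_oneHandleCancels` (THE BET, XL; SPC4-implied), `stub_propertyRClosing` (L, theorem-level modulo
`isUnknot_of_isIntegralSurgery_zero`, `exists_diffeomorph_comp_incl_eq`), `stub_nonMazurSector`
(residual, open-problem strength).  Composition `ContractibleTwistedDoubleStandard_of`: case split on
Stein-smallness of the two halves (classical), ball cases by symmetry of the crux hypotheses,
Mazur × Mazur through stubs 2 → 3 → 4, everything else through stub 5.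

Disproof / Negative lemmas honoured (imported above, `…Negative.LoadBearing`, `…Negative.DoubleBisection`):
every stub concluding `X ≅ S⁴` keeps the CONTRACTIBILITY of the halves (`not_crux_without_contractible`:
the empty bisection) — in stubs 3–4 in the form "`W` contractible, `V` connected, one `0`-handle" — and
the COVER / gluing condition (`not_crux_without_cover`: `S⁴ ⊔ S⁴`); no stub is an instance of a landed
Negative lemma; `double_standard_of_crux` (ψ = id sector = presentation spheres) lands inside
`stub_nonMazurSector` for ≥ 2 one-handles and inside the bet for Mazur doubles (Mazur 1961: known).
-/

noncomputable section

set_option linter.dupNamespace false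

open scoped Manifold ContDiff Topology
open Set Function Literature.Topology.FourManifolds Literature.Geometry.Symplectic

namespace Summit.SmoothPoincare4.SmoothPoincare4.Cruxes.ContractibleTwistedDoubleStandard.PropertyRMazurHalves

/-- Local notation: `𝕊 n` is the unit sphere in `EuclideanSpace ℝ (Fin (n + 1))`. -/
local notation "𝕊 " n:arg => (Metric.sphere (0 : EuclideanSpace ℝ (Fin (n + 1))) 1)
/-- **Fact-stub E (NAMED-FACT DEBT): Eliashberg 1990, Thm. 5.1 — every Stein filling of `S³` is `𝔻⁴`.**
VERBATIM the tree's named fact `Literature.Geometry.Symplectic.Eliashberg1990_steinFilling_sphere_three`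
(`SteinFillingSphere.lean`; partial proof programme in `SteinFillingSphere*.lean`); a discharge `…_holds` closes this
stub by `exact`.  Lead reshape m1 (2026-08-16): the ball-half stub is proved CONDITIONALLY on this fact and on Cerf, so
the two facts are filed as their own registered stubs instead of hiding inside a sorry. -/
theorem stub_factEliashbergFilling : Eliashberg1990_steinFilling_sphere_three := by
  sorry

/-- **Fact-stub C (NAMED-FACT DEBT): Cerf 1968, `Γ₄ = 0` — every twisted 4-sphere `𝔻⁴ ∪_φ 𝔻⁴` is `S⁴`.**
VERBATIM the tree's named fact `Literature.Topology.FourManifolds.cerf_twistedSphere_four` (`CerfGammaFour.lean`;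
reductions in `CerfGammaFourProofs.lean`); a discharge closes this stub by `exact`.  Lead reshape m1. -/
theorem stub_factCerf : cerf_twistedSphere_four := by
  sorry

/-- **Stub 1 (ball half; M, theorem-level modulo named facts).**  If the `J`-convex defining
function of the first half is Morse with at most one critical point, then `X ≅ S⁴`: the unique critical
point is the interior minimum, so `W₁ ≅ 𝔻⁴` (Milnor's disc theorem,
`nonempty_diffeomorph_closedBall_of_isMorseAdapted_of_isLocalMin` after rescaling `φ` to an adapted
function), the seam `e₁(∂W₁) = e₂(∂W₂)` is `≅ S³`, so `(W₂, J₂)` is a Stein filling of `S³`, hence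
`≅ 𝔻⁴` (`Eliashberg1990_steinFilling_sphere_three`), and `X = 𝔻⁴ ∪_ψ 𝔻⁴` is a twisted sphere, `≅ S⁴`
by Cerf (`cerf_twistedSphere_four`, `TwistedSpheres.lean`).  This is support item `SphereSeamStandard`
read on the crux's own data.  Used twice in the composition (the crux hypotheses are symmetric in the
two halves).  Honours `not_crux_without_contractible` (contractibility kept) and `not_crux_without_cover`.
Lead reshape m1: CONDITIONAL on the two named facts (fact-stubs E, C above), which the composition supplies;
the seam transfer `∂W₂ ≅ ∂W₁` is the LANDED `stub_seam` (p73294). -/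
theorem stub_ballHalf :
    Eliashberg1990_steinFilling_sphere_three → cerf_twistedSphere_four →
    ∀ (X : Type) [TopologicalSpace X] [T2Space X] [SecondCountableTopology X] [CompactSpace X]
      [ChartedSpace (EuclideanSpace ℝ (Fin 4)) X] [IsManifold (𝓡 4) ∞ X]
      (W₁ : Type) [TopologicalSpace W₁] [ChartedSpace (EuclideanHalfSpace 4) W₁]
      [IsManifold (𝓡∂ 4) ∞ W₁] [CompactSpace W₁] [ContractibleSpace W₁]
      (W₂ : Type) [TopologicalSpace W₂] [ChartedSpace (EuclideanHalfSpace 4) W₂]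
      [IsManifold (𝓡∂ 4) ∞ W₂] [CompactSpace W₂] [ContractibleSpace W₂]
      (J₁ : SteinStructure W₁) (J₂ : SteinStructure W₂) (e₁ : W₁ → X) (e₂ : W₂ → X),
      Manifold.IsSmoothEmbedding (𝓡∂ 4) (𝓡 4) ∞ e₁ → Manifold.IsSmoothEmbedding (𝓡∂ 4) (𝓡 4) ∞ e₂ →
      Set.range e₁ ∪ Set.range e₂ = Set.univ →
      Set.range e₁ ∩ Set.range e₂ = e₁ '' (𝓡∂ 4).boundary W₁ →
      Set.range e₁ ∩ Set.range e₂ = e₂ '' (𝓡∂ 4).boundary W₂ →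
      (∀ w₁ w₂, e₁ w₁ = e₂ w₂ →
        Submodule.map (mfderiv (𝓡∂ 4) (𝓡 4) e₁ w₁).toLinearMap (contactPlane J₁.J w₁) =
          Submodule.map (mfderiv (𝓡∂ 4) (𝓡 4) e₂ w₂).toLinearMap (contactPlane J₂.J w₂)) →
      IsMorse (𝓡∂ 4) J₁.φ → (criticalSet (𝓡∂ 4) J₁.φ).Subsingleton →
      Nonempty (X ≃ₘ⟮𝓡 4, 𝓡 4⟯ Metric.sphere (0 : EuclideanSpace ℝ (Fin 5)) 1) := by
  sorry

/-- **Stub 2 (turning the Mazur half upside down: the Legendrian dual handle; L, theorem-level).**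
If the `J`-convex function `φ₂` of `(W₂, J₂)` is Morse with one critical point of index `0`, `1`, `2` each
(STEIN-MAZUR TYPE: `W₂ = S¹ × B³ ∪` one Weinstein 2-handle), then inside the bisection
`X = e₁(W₁) ∪ e₂(W₂)`: the ascending (unstable) disc `D` of the index-2 point for the Liouville
gradient of `φ₂` is LAGRANGIAN (CieliebakEliashberg2012, Ch. 11: unstable manifolds of Liouville fields
are coisotropic — in real dimension 4 and index 2, Lagrangian; stable ones isotropic), so its boundary, the belt
circle `β ⊂ ∂W₂`, is Legendrian for `ξ₂` with `tb_D(β) = -1`; transported by the seam contactomorphism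
`ψ = e₂⁻¹ ∘ e₁` (orientation-preserving: both `ξᵢ` are positive), `Λ = ψ⁻¹(β)` is a Legendrian knot in
`(∂W₁, ξ₁)` (`IsLegendrianKnot J₁.J Λ`, from the contact-plane matching), and `e₁(W₁) ∪ e₂({φ₂ ≥ c})`
(`c` between the index-1 and index-2 critical values after Morse–Smale genericity) is `W₁` with ONE
2-handle attached along `Λ` with the `D`-framing = `tb(Λ) + 1`, i.e. twisting number `+1`
(`SteinStructure.twisting`; Weinstein handles have `-1`; sanity check `D(B⁴)`: dual handle = `0`-framed
meridian, `tb = -1`), realised by an attaching map with `attachingCircle = Λ`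
(`exists_handleAttachingMap_of_isKnotFraming_holds`); the rest `V = e₂({φ₂ ≤ c})` is a compact connected
orientable `(1,1)`-handlebody (`≅ S¹ × B³`) and `X = P ∪_φ V` along the level `{φ₂ = c}`.  This is
Ding–Geiges' "contact `(+1)`-surgery undoes Legendrian surgery" in handle language; shared with line
`legendrian-belt-unlinking` (its `n = 1` case).  Sources: CieliebakEliashberg2012 Ch. 11 (lit want acq-04641); DingGeiges2001 = arXiv:math/0107045 §3 (read, p. 7 of the arXiv
text: in Weinstein's model the belt circle `L' = V' ∩ {y = t = 0}` is Legendrian on the convex boundary and the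
surgery framing of the upside-down handle "makes one positive twist relative to the contact framing … Hence this
amounts to a contact `(+1)`-surgery"; and "the composition of a contact `(-1)`-surgery and a contact `(+1)`-surgery
leads to a manifold contactomorphic to the one we started from");
Gompf1998 §1; arXiv:1603.05090 Rmk 2.1(c). -/
theorem stub_upsideDownLegendrianDual :
    ∀ (X : Type) [TopologicalSpace X] [T2Space X] [SecondCountableTopology X] [CompactSpace X]
      [ChartedSpace (EuclideanSpace ℝ (Fin 4)) X] [IsManifold (𝓡 4) ∞ X]
      (W₁ : Type) [TopologicalSpace W₁] [ChartedSpace (EuclideanHalfSpace 4) W₁]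
      [IsManifold (𝓡∂ 4) ∞ W₁] [CompactSpace W₁] [ContractibleSpace W₁]
      (W₂ : Type) [TopologicalSpace W₂] [ChartedSpace (EuclideanHalfSpace 4) W₂]
      [IsManifold (𝓡∂ 4) ∞ W₂] [CompactSpace W₂] [ContractibleSpace W₂]
      (J₁ : SteinStructure W₁) (J₂ : SteinStructure W₂) (e₁ : W₁ → X) (e₂ : W₂ → X),
      Manifold.IsSmoothEmbedding (𝓡∂ 4) (𝓡 4) ∞ e₁ → Manifold.IsSmoothEmbedding (𝓡∂ 4) (𝓡 4) ∞ e₂ →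
      Set.range e₁ ∪ Set.range e₂ = Set.univ →
      Set.range e₁ ∩ Set.range e₂ = e₁ '' (𝓡∂ 4).boundary W₁ →
      Set.range e₁ ∩ Set.range e₂ = e₂ '' (𝓡∂ 4).boundary W₂ →
      (∀ w₁ w₂, e₁ w₁ = e₂ w₂ →
        Submodule.map (mfderiv (𝓡∂ 4) (𝓡 4) e₁ w₁).toLinearMap (contactPlane J₁.J w₁) =
          Submodule.map (mfderiv (𝓡∂ 4) (𝓡 4) e₂ w₂).toLinearMap (contactPlane J₂.J w₂)) →
      IsMorse (𝓡∂ 4) J₂.φ →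
      (∀ z, IsMCriticalPt (𝓡∂ 4) J₂.φ z → morseIndex (𝓡∂ 4) J₂.φ z ≤ 2) →
      (criticalSetOfIndex (𝓡∂ 4) J₂.φ 0).ncard = 1 → (criticalSetOfIndex (𝓡∂ 4) J₂.φ 1).ncard = 1 →
      (criticalSetOfIndex (𝓡∂ 4) J₂.φ 2).ncard = 1 →
      ∀ [T2Space W₁],
      ∃ (Λ : 𝕊 1 → W₁) (h : HandleAttachingMap 3 2 W₁),
        IsLegendrianKnot J₁.J Λ ∧ h.attachingCircle = Λ ∧ J₁.twisting Λ h.attachingFraming = 1 ∧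
        ∃ (P : Type) (_ : TopologicalSpace P) (_ : T2Space P) (_ : SecondCountableTopology P)
          (_ : ChartedSpace (EuclideanHalfSpace 4) P) (_ : IsManifold (𝓡∂ 4) ∞ P) (_ : CompactSpace P)
          (V : Type) (_ : TopologicalSpace V) (_ : T2Space V) (_ : SecondCountableTopology V)
          (_ : ChartedSpace (EuclideanHalfSpace 4) V) (_ : IsManifold (𝓡∂ 4) ∞ V) (_ : CompactSpace V)
          (_ : ConnectedSpace V)
          (bP : BoundaryData (𝓡∂ 4) P (𝓡 3)) (bV : BoundaryData (𝓡∂ 4) V (𝓡 3))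
          (φ : bP.carrier ≃ₘ⟮𝓡 3, 𝓡 3⟯ bV.carrier),
          h.IsAttachment (𝓡∂ 4) P ∧
          (∃ f : V → ℝ, IsMorseAdapted (𝓡∂ 4) f ∧
          (∀ z, IsMCriticalPt (𝓡∂ 4) f z → morseIndex (𝓡∂ 4) f z ≤ 1) ∧
          (criticalSetOfIndex (𝓡∂ 4) f 0).ncard = 1 ∧ (criticalSetOfIndex (𝓡∂ 4) f 1).ncard = 1) ∧
          IsOrientable (𝓡∂ 4) V ∧ IsBoundaryGluing bP bV φ (𝓡 4) X := by
  sorry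

/-- **Stub 3 — THE BET (one-handle cancellation for Legendrian `tb+1`-traces over Mazur-type Stein
domains; XL, open; SPC4-implied).**  Let `(W, S)` be a compact contractible Stein domain of Stein-Mazur type
(`S.φ` Morse, profile `(1,1,1)`), `Λ ⊂ (∂W, ξ_S)` a Legendrian knot, `P = W ∪_Λ h²` the 2-handle attachment
with twisting `+1` (framing `tb(Λ) + 1`), and suppose `P` closes up, `X = P ∪_φ V` with `V` a compact connected
orientable `(1,1)`-handlebody (`S¹ × B³`), to a closed 4-manifold.  Then the 1-handle of `W` CANCELS in `P`:
`P` carries an adapted Morse function with one critical point of index `0`, none of index `1`, one of index `2`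
(`P` is a knot trace `B⁴ ∪_K h²`).  Known instances (card, verified by triage): `ψ = id` (Λ = `0`-framed
meridian of `K`: slide `K` over `Λ` to undo its self-clasps, then cancel — Mazur 1961 without 5-manifolds) and
the dot↔zero cork twists of symmetric-link Mazur corks (Λ = meridian of the dotted circle cancels it —
Akbulut–Yasui arXiv:0812.5098 §7.2).  The bet: for EVERY Legendrian `tb+1`-closing `Λ` one of `K`, `Λ` slides
to a geometric dual of the 1-handle (the contact constraints: `Λ` Legendrian in `(S¹ × S² ∖ K, ξ_std)` with
tight `(+1)`-surgery).  Why it might fail: Gompf's `ℤ`-corks `C(r,s;m)` twisted by `f^k`, `k ≥ 2`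
(arXiv:1603.05090 Q 2.2) if `f^k` is a contactomorphism of a `C`-fillable structure — first kit job.  Any
`X` here is a homotopy 4-sphere (`π₁(P) = π₁(W)/⟨Λ⟩ = 1`, `χ = 2`), so the stub is implied by SPC4 and not
cheaply refutable.  Barrier: `StrictPropertyTwoRBarrier` does NOT bite (one 1-handle: Property (1)R, a
theorem, is all that stub 4 uses).  Honours `not_crux_without_contractible` (`W` contractible) and
`not_crux_without_cover` (`IsBoundaryGluing`). -/
theorem stub_oneHandleCancels :
    ∀ (W : Type) [TopologicalSpace W] [T2Space W] [ChartedSpace (EuclideanHalfSpace 4) W]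
      [IsManifold (𝓡∂ 4) ∞ W] [CompactSpace W] [ContractibleSpace W] (S : SteinStructure W),
      IsMorse (𝓡∂ 4) S.φ →
      (∀ z, IsMCriticalPt (𝓡∂ 4) S.φ z → morseIndex (𝓡∂ 4) S.φ z ≤ 2) →
      (criticalSetOfIndex (𝓡∂ 4) S.φ 0).ncard = 1 → (criticalSetOfIndex (𝓡∂ 4) S.φ 1).ncard = 1 →
      (criticalSetOfIndex (𝓡∂ 4) S.φ 2).ncard = 1 →
      ∀ (Λ : 𝕊 1 → W) (h : HandleAttachingMap 3 2 W),
      IsLegendrianKnot S.J Λ → h.attachingCircle = Λ → S.twisting Λ h.attachingFraming = 1 →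
      ∀ (P : Type) [TopologicalSpace P] [T2Space P] [SecondCountableTopology P]
      [ChartedSpace (EuclideanHalfSpace 4) P] [IsManifold (𝓡∂ 4) ∞ P] [CompactSpace P],
      h.IsAttachment (𝓡∂ 4) P →
      ∀ (V : Type) [TopologicalSpace V] [T2Space V] [SecondCountableTopology V]
      [ChartedSpace (EuclideanHalfSpace 4) V] [IsManifold (𝓡∂ 4) ∞ V] [CompactSpace V] [ConnectedSpace V],
      (∃ f : V → ℝ, IsMorseAdapted (𝓡∂ 4) f ∧
          (∀ z, IsMCriticalPt (𝓡∂ 4) f z → morseIndex (𝓡∂ 4) f z ≤ 1) ∧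
          (criticalSetOfIndex (𝓡∂ 4) f 0).ncard = 1 ∧ (criticalSetOfIndex (𝓡∂ 4) f 1).ncard = 1) →
      IsOrientable (𝓡∂ 4) V →
      ∀ (bP : BoundaryData (𝓡∂ 4) P (𝓡 3)) (bV : BoundaryData (𝓡∂ 4) V (𝓡 3))
        (φ : bP.carrier ≃ₘ⟮𝓡 3, 𝓡 3⟯ bV.carrier)
        (X : Type) [TopologicalSpace X] [T2Space X] [SecondCountableTopology X] [CompactSpace X]
      [ChartedSpace (EuclideanSpace ℝ (Fin 4)) X] [IsManifold (𝓡 4) ∞ X],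
      IsBoundaryGluing bP bV φ (𝓡 4) X →
      ∃ g : P → ℝ, IsMorseAdapted (𝓡∂ 4) g ∧
        (∀ z, IsMCriticalPt (𝓡∂ 4) g z → morseIndex (𝓡∂ 4) g z ≤ 2) ∧
        (criticalSetOfIndex (𝓡∂ 4) g 0).ncard = 1 ∧ criticalSetOfIndex (𝓡∂ 4) g 1 = ∅ ∧
        (criticalSetOfIndex (𝓡∂ 4) g 2).ncard = 1 := by
  sorry

/-- **Stub 4 (Property R closes the trace; L, theorem-level modulo named facts).**  A compact
4-manifold `P` with an adapted Morse function of profile `(1,0,1)` is a knot trace `X_n(K) = B⁴ ∪_K h²`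
(Milnor 1963 Thm 3.2; `HandlePresentations.lean`); if `X = P ∪_φ V` is closed with `V` a compact connected
orientable `(1,1)`-handlebody, then `V ≅ S¹ × B³` (`nonempty_diffeomorph_of_hasHandleDecomposition_handleCount_one`,
UNIQ₄), so `S³_n(K) = ∂P ≅ ∂V = S¹ × S²`, whence `n = 0` (homology) and `K` is the unknot by GABAI'S PROPERTY R
(`isUnknot_of_isIntegralSurgery_zero`, reduced in-tree to `Knot.hasSeifertSurfaceOfGenus_le_of_isIntegralSurgery_zero`
= Gabai 1987 Cor 8.3), so `P ≅ S² × D²` and `X ≅ S² × D² ∪_φ S¹ × B³ ≅ S⁴` for every `φ` by Laudenbach–Poénaru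
(`exists_diffeomorph_comp_incl_eq`, `nonempty_diffeomorph_of_isBoundaryGluing_twoHandlebody`).  Sources:
GabaiJDG1987 Cor 8.3/Rmk 8.5; LaudenbachPoenaru1972; GompfStipsicz1999 §4.4, §5.5.  No barrier applies
(Property (1)R is a theorem; `StrictPropertyTwoRBarrier` concerns ≥ 2 components). -/
theorem stub_propertyRClosing :
    ∀ (P : Type) [TopologicalSpace P] [T2Space P] [SecondCountableTopology P]
      [ChartedSpace (EuclideanHalfSpace 4) P] [IsManifold (𝓡∂ 4) ∞ P] [CompactSpace P] (g : P → ℝ),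
      IsMorseAdapted (𝓡∂ 4) g →
      (∀ z, IsMCriticalPt (𝓡∂ 4) g z → morseIndex (𝓡∂ 4) g z ≤ 2) →
      (criticalSetOfIndex (𝓡∂ 4) g 0).ncard = 1 → criticalSetOfIndex (𝓡∂ 4) g 1 = ∅ →
      (criticalSetOfIndex (𝓡∂ 4) g 2).ncard = 1 →
      ∀ (V : Type) [TopologicalSpace V] [T2Space V] [SecondCountableTopology V]
      [ChartedSpace (EuclideanHalfSpace 4) V] [IsManifold (𝓡∂ 4) ∞ V] [CompactSpace V] [ConnectedSpace V],
      (∃ f : V → ℝ, IsMorseAdapted (𝓡∂ 4) f ∧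
          (∀ z, IsMCriticalPt (𝓡∂ 4) f z → morseIndex (𝓡∂ 4) f z ≤ 1) ∧
          (criticalSetOfIndex (𝓡∂ 4) f 0).ncard = 1 ∧ (criticalSetOfIndex (𝓡∂ 4) f 1).ncard = 1) →
      IsOrientable (𝓡∂ 4) V →
      ∀ (bP : BoundaryData (𝓡∂ 4) P (𝓡 3)) (bV : BoundaryData (𝓡∂ 4) V (𝓡 3))
        (φ : bP.carrier ≃ₘ⟮𝓡 3, 𝓡 3⟯ bV.carrier)
        (X : Type) [TopologicalSpace X] [T2Space X] [SecondCountableTopology X] [CompactSpace X]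
      [ChartedSpace (EuclideanSpace ℝ (Fin 4)) X] [IsManifold (𝓡 4) ∞ X],
      IsBoundaryGluing bP bV φ (𝓡 4) X →
      Nonempty (X ≃ₘ⟮𝓡 4, 𝓡 4⟯ Metric.sphere (0 : EuclideanSpace ℝ (Fin 5)) 1) := by
  sorry

/-- **Stub 5 (the residual sector; open-problem strength — NOT reached by this line's lever).**
The crux restricted to bisections in which NOT both halves are Stein-small (Stein-small: some Stein
structure on the same `W` with the same contact planes along `∂W` has a Morse `J`-convex function with at
most one critical point — ball type — or with profile `(1,1,1)` — Mazur type), i.e. some half needs at least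
two 1-handles in every Stein handle structure compatible with its boundary contact structure.  Declared scope boundary of the card ("Transfer: none beyond the sector"; triage r1-1/2/3: the
engine is the `n = 1` closing module): here `X^{(2)} = ♮ᵏ S¹ × B³ ∪ (k + m)` 2-handles with
`max(k,m) ≥ 2`, cancelling the 1-handles is a slide-equivalence problem and
`Literature.Barriers.SmoothPoincare4.StrictPropertyTwoRBarrier` (Property 2R would trivialise AC-hard
presentations) BITES; the `ψ = id` part alone is standardness of all presentation spheres with ≥ 2 generators
(`Negative.DoubleBisection.double_standard_of_crux`, Gompf 1991, Meier–Zupan arXiv:1904.08527).  Filed so that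
`ContractibleTwistedDoubleStandard_of` concludes the crux by name; the lead should treat it as the interface to
line `legendrian-belt-unlinking` (LPR with `n ≥ 2` components, same object `Λ = ψ⁻¹`(belt link)) rather than
attack it with this lever.  Why it might fail: an exotic contact twisted double with many-handled halves (none
known); SPC4-implied.  Honours `not_crux_without_contractible`, `not_crux_without_cover` (all crux hypotheses kept). -/
theorem stub_nonMazurSector :
    ∀ (X : Type) [TopologicalSpace X] [T2Space X] [SecondCountableTopology X] [CompactSpace X]
      [ChartedSpace (EuclideanSpace ℝ (Fin 4)) X] [IsManifold (𝓡 4) ∞ X]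
      (W₁ : Type) [TopologicalSpace W₁] [ChartedSpace (EuclideanHalfSpace 4) W₁]
      [IsManifold (𝓡∂ 4) ∞ W₁] [CompactSpace W₁] [ContractibleSpace W₁]
      (W₂ : Type) [TopologicalSpace W₂] [ChartedSpace (EuclideanHalfSpace 4) W₂]
      [IsManifold (𝓡∂ 4) ∞ W₂] [CompactSpace W₂] [ContractibleSpace W₂]
      (J₁ : SteinStructure W₁) (J₂ : SteinStructure W₂) (e₁ : W₁ → X) (e₂ : W₂ → X),
      Manifold.IsSmoothEmbedding (𝓡∂ 4) (𝓡 4) ∞ e₁ → Manifold.IsSmoothEmbedding (𝓡∂ 4) (𝓡 4) ∞ e₂ →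
      Set.range e₁ ∪ Set.range e₂ = Set.univ →
      Set.range e₁ ∩ Set.range e₂ = e₁ '' (𝓡∂ 4).boundary W₁ →
      Set.range e₁ ∩ Set.range e₂ = e₂ '' (𝓡∂ 4).boundary W₂ →
      (∀ w₁ w₂, e₁ w₁ = e₂ w₂ →
        Submodule.map (mfderiv (𝓡∂ 4) (𝓡 4) e₁ w₁).toLinearMap (contactPlane J₁.J w₁) =
          Submodule.map (mfderiv (𝓡∂ 4) (𝓡 4) e₂ w₂).toLinearMap (contactPlane J₂.J w₂)) →
      ¬ ((∃ S : SteinStructure W₁, (∀ x ∈ (𝓡∂ 4).boundary W₁, contactPlane S.J x = contactPlane J₁.J x) ∧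
          IsMorse (𝓡∂ 4) S.φ ∧
          ((criticalSet (𝓡∂ 4) S.φ).Subsingleton ∨
            ((∀ z, IsMCriticalPt (𝓡∂ 4) S.φ z → morseIndex (𝓡∂ 4) S.φ z ≤ 2) ∧
              (criticalSetOfIndex (𝓡∂ 4) S.φ 0).ncard = 1 ∧ (criticalSetOfIndex (𝓡∂ 4) S.φ 1).ncard = 1 ∧
              (criticalSetOfIndex (𝓡∂ 4) S.φ 2).ncard = 1))) ∧
          (∃ S : SteinStructure W₂, (∀ x ∈ (𝓡∂ 4).boundary W₂, contactPlane S.J x = contactPlane J₂.J x) ∧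
          IsMorse (𝓡∂ 4) S.φ ∧
          ((criticalSet (𝓡∂ 4) S.φ).Subsingleton ∨
            ((∀ z, IsMCriticalPt (𝓡∂ 4) S.φ z → morseIndex (𝓡∂ 4) S.φ z ≤ 2) ∧
              (criticalSetOfIndex (𝓡∂ 4) S.φ 0).ncard = 1 ∧ (criticalSetOfIndex (𝓡∂ 4) S.φ 1).ncard = 1 ∧
              (criticalSetOfIndex (𝓡∂ 4) S.φ 2).ncard = 1)))) →
      Nonempty (X ≃ₘ⟮𝓡 4, 𝓡 4⟯ Metric.sphere (0 : EuclideanSpace ℝ (Fin 5)) 1) := by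
  sorry

/-- **Composition (kernel-checked, no `sorry` of its own): the crux BY NAME from the five registered stubs, each used
BY NAME** (skeleton convention: `sorryAx` enters only through `stub_*`).  Classical case
split on Stein-smallness of the two halves; a ball half is handled by stub 1 (applied to the symmetric data when
it is the second half); two Stein-Mazur halves go through stub 2 (upside down: Legendrian dual handle `Λ`,
twisting `+1`, `X = P ∪_φ V`), stub 3 (the 1-handle cancels in `P`) and stub 4 (Property R + Laudenbach–Poénaru);
everything else is the residual stub 5.  The Stein structures `Sᵢ` produced by smallness induce the same contact
planes along `∂Wᵢ`, and seam points are boundary points (landed Negative lemma `Negative.seam_mem_boundary`,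
`LoadBearing.lean`), so the contact-plane matching transfers. -/
theorem ContractibleTwistedDoubleStandard_of :
    Summit.SmoothPoincare4.SmoothPoincare4.Theses.ConvexBisection.ContractibleTwistedDoubleStandard := by
  intro X _ _ _ _ _ _ W₁ _ _ _ _ _ W₂ _ _ _ _ _ J₁ J₂ e₁ e₂ h1 h2 hcov hL hR hC
  by_cases hsm : ((∃ S : SteinStructure W₁, (∀ x ∈ (𝓡∂ 4).boundary W₁, contactPlane S.J x = contactPlane J₁.J x) ∧
          IsMorse (𝓡∂ 4) S.φ ∧
          ((criticalSet (𝓡∂ 4) S.φ).Subsingleton ∨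
            ((∀ z, IsMCriticalPt (𝓡∂ 4) S.φ z → morseIndex (𝓡∂ 4) S.φ z ≤ 2) ∧
              (criticalSetOfIndex (𝓡∂ 4) S.φ 0).ncard = 1 ∧ (criticalSetOfIndex (𝓡∂ 4) S.φ 1).ncard = 1 ∧
              (criticalSetOfIndex (𝓡∂ 4) S.φ 2).ncard = 1))) ∧
          (∃ S : SteinStructure W₂, (∀ x ∈ (𝓡∂ 4).boundary W₂, contactPlane S.J x = contactPlane J₂.J x) ∧
          IsMorse (𝓡∂ 4) S.φ ∧
          ((criticalSet (𝓡∂ 4) S.φ).Subsingleton ∨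
            ((∀ z, IsMCriticalPt (𝓡∂ 4) S.φ z → morseIndex (𝓡∂ 4) S.φ z ≤ 2) ∧
              (criticalSetOfIndex (𝓡∂ 4) S.φ 0).ncard = 1 ∧ (criticalSetOfIndex (𝓡∂ 4) S.φ 1).ncard = 1 ∧
              (criticalSetOfIndex (𝓡∂ 4) S.φ 2).ncard = 1))))
  · obtain ⟨⟨S₁, hJ1, hM1, hs1⟩, ⟨S₂, hJ2, hM2, hs2⟩⟩ := hsm
    have hC' : ∀ w₁ w₂, e₁ w₁ = e₂ w₂ →
        Submodule.map (mfderiv (𝓡∂ 4) (𝓡 4) e₁ w₁).toLinearMap (contactPlane S₁.J w₁) =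
          Submodule.map (mfderiv (𝓡∂ 4) (𝓡 4) e₂ w₂).toLinearMap (contactPlane S₂.J w₂) := by
      intro w₁ w₂ hw
      obtain ⟨hb1, hb2⟩ :=
        Summit.SmoothPoincare4.SmoothPoincare4.Theorems.ContractibleTwistedDoubleStandard.Negative.seam_mem_boundary
          h1 h2 hL hR hw
      rw [hJ1 w₁ hb1, hJ2 w₂ hb2]
      exact hC w₁ w₂ hw
    rcases hs1 with hb1 | ⟨hi1, h01, h11, h21⟩
    · exact stub_ballHalf stub_factEliashbergFilling stub_factCerf X W₁ W₂ S₁ S₂ e₁ e₂ h1 h2 hcov hL hR hC' hM1 hb1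
    rcases hs2 with hb2 | ⟨hi2, h02, h12, h22⟩
    · refine stub_ballHalf stub_factEliashbergFilling stub_factCerf X W₂ W₁ S₂ S₁ e₂ e₁ h2 h1 ?_ ?_ ?_ ?_ hM2 hb2
      · rw [Set.union_comm]; exact hcov
      · rw [Set.inter_comm]; exact hR
      · rw [Set.inter_comm]; exact hL
      · intro w₂ w₁ hw
        exact (hC' w₁ w₂ hw.symm).symm
    haveI hT2 : T2Space W₁ := h1.isEmbedding.t2Space
    obtain ⟨Λ, h, hLeg, hcirc, htw, P, iP₁, iP₂, iP₃, iP₄, iP₅, iP₆, V, iV₁, iV₂, iV₃, iV₄, iV₅, iV₆, iV₇,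
        bP, bV, φ, hatt, hV, hVo, hglue⟩ :=
      stub_upsideDownLegendrianDual X W₁ W₂ S₁ S₂ e₁ e₂ h1 h2 hcov hL hR hC' hM2 hi2 h02 h12 h22
    obtain ⟨g, hg, hgi, hg0, hg1, hg2⟩ :=
      stub_oneHandleCancels W₁ S₁ hM1 hi1 h01 h11 h21 Λ h hLeg hcirc htw P hatt V hV hVo bP bV φ X hglue
    exact stub_propertyRClosing P g hg hgi hg0 hg1 hg2 V hV hVo bP bV φ X hglue
  · exact stub_nonMazurSector X W₁ W₂ J₁ J₂ e₁ e₂ h1 h2 hcov hL hR hC hsm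

end Summit.SmoothPoincare4.SmoothPoincare4.Cruxes.ContractibleTwistedDoubleStandard.PropertyRMazurHalves

end

-- h21 skeleton audit (lead reshape m1): composition concludes the crux by name; sorries only in the stubs
#h21_check_skeleton "stmt-SmoothPoincare4-3546" Summit.SmoothPoincare4.SmoothPoincare4.Theses.ConvexBisection.ContractibleTwistedDoubleStandard stub_factEliashbergFilling stub_factCerf stub_ballHalf stub_upsideDownLegendrianDual stub_oneHandleCancels stub_propertyRClosing stub_nonMazurSector
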